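import Summits.AtomisticToContinuum.Crystallization.Theorems.FrustratedLawDichotomyCellGrid

/-!
# FrustratedLawDichotomy · crux `AperiodicFrustratedLawGap` (stmt-AtomisticToContinuum-27623) — CELL-SOUND XI: THE ORIENTATION-FREE GRID
TOLERANCE LEMMA (cell decomp-a2c, lens-5 g113)

(J) `…CellGrid.row_cover` rounds inside an ENTRYWISE box `box lo hi`.  The K-files of record certify over the NEAR-IDENTITY STRAIN BOX
`nearIdBox ε := {F ∣ |FᵀF − 1|ᵢⱼ ≤ ε}` ((260) `rowFloor_of_nearIdBox`), which is `O(3)`-saturated: ONE row per cell covers every orientation.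
Its cover needs no corner condition, only slack in `ε`: round `F` entrywise to ANY rational `F'` within `η`; then
`|F'ᵀF' − FᵀF|ᵢⱼ ≤ 3η(2 + 2ε + η)` (`gram_moved_le`), so `F ∈ nearIdBox ε_cov`, `ε_cov + 3η(2 + 2ε_cov + η) ≤ ε` put `F'` in
`ratBox (nearIdBox ε)`, and (J) `coherentAt_mono_of_moved` + `norm_posL_sub_posL_le` move the template by `≤ 3ηA`:
★ `row_cover_nearId` / `rowHalo_cover_nearId`.  Numbers of record: `ε = 2⁻¹⁰`, `η = 2⁻²⁵`, `A ≤ 15`, `τ_row = 1/1024` ⇒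
`τ_cov = 511/524288`, `ε_cov = 2⁻¹⁰ − 2⁻²²` (`epsCov_le`).

House conventions: SI units · italic scalars, bold vectors, sans-serif tensors · numbered formulae only when referenced · en-dash for
ranges · References = cited works, numbered, alphabetical · no footnotes; Remarks at section ends · British spelling, -ise · Lennard-Jones
hyphenated; NASH capitalised as the Statement's notion · "folklore" tags standard bookkeeping; no new references are cited in this file.
-/

noncomputable section

namespace Summit.AtomisticToContinuum.Crystallization.Theorems.FrustratedLawDichotomyCellGridFree

open MeasureTheory Metric Set
open scoped BigOperators
open Summit.AtomisticToContinuum.Crystallization.Theorems.ChargedEnergyGapNegative (E3)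
open Summit.AtomisticToContinuum.Crystallization.Theorems.FrustratedLawDichotomyCoherentSets (coherentAt)
open Summit.AtomisticToContinuum.Crystallization.Theorems.FrustratedLawDichotomyCoherentOn (coherentOn coherentAt_eq_coherentOn)
open Summit.AtomisticToContinuum.Crystallization.Theorems.FrustratedLawDichotomyCoherentFloorHalo (haloWindow)
open Summit.AtomisticToContinuum.Crystallization.Theorems.FrustratedLawDichotomyCellRows (ratBox mem_ratBox)
open Summit.AtomisticToContinuum.Crystallization.Theorems.FrustratedLawDichotomyCellMetric (posL)
open Summit.AtomisticToContinuum.Crystallization.Theorems.FrustratedLawDichotomyCellGrid (coherentOn_mono_of_moved norm_posL_sub_posL_le)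

variable {ι : Type*}

/-- the NEAR-IDENTITY STRAIN BOX `{F ∣ |FᵀF − 1|ᵢⱼ ≤ ε}` — the `O(3)`-saturated parameter box of a class-A/H cell of record. -/
def nearIdBox (ε : ℝ) : Set (Matrix (Fin 3) (Fin 3) ℝ) := {F | ∀ i j, |(F.transpose * F) i j - (if i = j then 1 else 0)| ≤ ε}

/-- membership, unfolded (the `hB` of (260) `rowFloor_of_nearIdBox` for `B := nearIdBox ε` is `fun F hF => hF`). [folklore] -/
theorem mem_nearIdBox {ε : ℝ} {F : Matrix (Fin 3) (Fin 3) ℝ} : F ∈ nearIdBox ε ↔ ∀ i j, |(F.transpose * F) i j - (if i = j then 1 else 0)| ≤ ε :=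
  Iff.rfl

/-- free rational rounding: every real matrix has a rational matrix within `η` entrywise. [folklore] -/
theorem exists_rat_near_free (F : Matrix (Fin 3) (Fin 3) ℝ) {η : ℝ} (hη : 0 < η) :
    ∃ f : Fin 3 → Fin 3 → ℚ, ∀ i j, |F i j - f i j| ≤ η := by
  have h : ∀ i j, ∃ q : ℚ, |F i j - q| ≤ η := by
    intro i j
    obtain ⟨q, hq1, hq2⟩ := exists_rat_btwn (show F i j - η < F i j + η by linarith)
    exact ⟨q, abs_le.mpr ⟨by linarith, by linarith⟩⟩
  choose f hf using h
  exact ⟨f, hf⟩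

/-- entries of a near-identity-Gram matrix are bounded: `|F k j| ≤ 1 + ε`. [folklore] -/
theorem entry_le_of_nearId {ε : ℝ} {F : Matrix (Fin 3) (Fin 3) ℝ} (hF : F ∈ nearIdBox ε) (hε : 0 ≤ ε) (k j : Fin 3) : |F k j| ≤ 1 + ε := by
  have hjj := hF j j
  simp only [if_true] at hjj
  have hdiag : (F.transpose * F) j j = ∑ k, F k j ^ 2 := by
    simp only [Matrix.mul_apply, Matrix.transpose_apply]
    exact Finset.sum_congr rfl fun k _ => by ring
  have hsum : ∑ k, F k j ^ 2 ≤ 1 + ε := by rw [← hdiag]; linarith [(abs_le.mp hjj).2]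
  have hk : F k j ^ 2 ≤ 1 + ε := (Finset.single_le_sum (f := fun k => F k j ^ 2) (fun i _ => sq_nonneg _) (Finset.mem_univ k)).trans hsum
  have h1 : F k j ^ 2 ≤ (1 + ε) ^ 2 := hk.trans (by nlinarith)
  exact abs_le_of_sq_le_sq h1 (by linarith)

/-- ★ Gram entries move little under entrywise rounding: `|F'ᵀF' − FᵀF|ᵢⱼ ≤ 3η(2 + 2ε + η)` for `F ∈ nearIdBox ε`, `|F − F'| ≤ η`.
[folklore] -/
theorem gram_moved_le {ε η : ℝ} {F F' : Matrix (Fin 3) (Fin 3) ℝ} (hF : F ∈ nearIdBox ε) (hε : 0 ≤ ε) (hFF : ∀ i j, |F i j - F' i j| ≤ η)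
    (i j : Fin 3) : |(F'.transpose * F') i j - (F.transpose * F) i j| ≤ 3 * η * (2 + 2 * ε + η) := by
  have hη : 0 ≤ η := (abs_nonneg _).trans (hFF 0 0)
  have hterm : ∀ k, |F' k i * F' k j - F k i * F k j| ≤ η * (2 + 2 * ε + η) := by
    intro k
    have h1 : |F' k i - F k i| ≤ η := by rw [abs_sub_comm]; exact hFF k i
    have h2 : |F' k j - F k j| ≤ η := by rw [abs_sub_comm]; exact hFF k j
    have h3 : |F k i| ≤ 1 + ε := entry_le_of_nearId hF hε k i
    have h4 : |F k j| ≤ 1 + ε := entry_le_of_nearId hF hε k j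
    have h5 : |F' k j| ≤ 1 + ε + η := by
      calc |F' k j| = |F k j + (F' k j - F k j)| := by ring_nf
        _ ≤ |F k j| + |F' k j - F k j| := abs_add_le _ _
        _ ≤ 1 + ε + η := by linarith
    have hsplit : F' k i * F' k j - F k i * F k j = (F' k i - F k i) * F' k j + F k i * (F' k j - F k j) := by ring
    rw [hsplit]
    calc |(F' k i - F k i) * F' k j + F k i * (F' k j - F k j)|
        ≤ |(F' k i - F k i) * F' k j| + |F k i * (F' k j - F k j)| := abs_add_le _ _
      _ = |F' k i - F k i| * |F' k j| + |F k i| * |F' k j - F k j| := by rw [abs_mul, abs_mul]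
      _ ≤ η * (1 + ε + η) + (1 + ε) * η := add_le_add (mul_le_mul h1 h5 (abs_nonneg _) hη) (mul_le_mul h3 h2 (abs_nonneg _) (by linarith))
      _ = η * (2 + 2 * ε + η) := by ring
  have hsum : (F'.transpose * F') i j - (F.transpose * F) i j = ∑ k, (F' k i * F' k j - F k i * F k j) := by
    simp only [Matrix.mul_apply, Matrix.transpose_apply, ← Finset.sum_sub_distrib]
  rw [hsum]
  calc |∑ k, (F' k i * F' k j - F k i * F k j)| ≤ ∑ k, |F' k i * F' k j - F k i * F k j| := Finset.abs_sum_le_sum_abs _ _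
    _ ≤ ∑ _k : Fin 3, η * (2 + 2 * ε + η) := Finset.sum_le_sum fun k _ => hterm k
    _ = 3 * η * (2 + 2 * ε + η) := by simp [Finset.sum_const]; ring

/-- ★ the rounded matrix stays in the (slightly larger) strain box. [folklore] -/
theorem mem_nearIdBox_of_moved {εc ε η : ℝ} {F F' : Matrix (Fin 3) (Fin 3) ℝ} (hF : F ∈ nearIdBox εc) (hεc : 0 ≤ εc)
    (hFF : ∀ i j, |F i j - F' i j| ≤ η) (hεε : εc + 3 * η * (2 + 2 * εc + η) ≤ ε) : F' ∈ nearIdBox ε := by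
  intro i j
  have h1 := hF i j
  have h2 := gram_moved_le hF hεc hFF i j
  calc |(F'.transpose * F') i j - (if i = j then 1 else 0)|
      = |((F'.transpose * F') i j - (F.transpose * F) i j) + ((F.transpose * F) i j - (if i = j then 1 else 0))| := by ring_nf
    _ ≤ |(F'.transpose * F') i j - (F.transpose * F) i j| + |(F.transpose * F) i j - (if i = j then 1 else 0)| := abs_add_le _ _
    _ ≤ ε := by linarith

/-- ★★ **ORIENTATION-FREE GRID TOLERANCE (class A).**  Every configuration coherent at SOME real `F ∈ nearIdBox ε_cov` at radius `τ_cov`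
is coherent at a RATIONAL `F' ∈ nearIdBox ε` at radius `τ_row`, provided `τ_cov + 3ηA ≤ τ_row` and `ε_cov + 3η(2 + 2ε_cov + η) ≤ ε` for some
`η > 0` (`‖a m‖₂ ≤ A` on `M`).  ONE row per cell, all orientations. [folklore] -/
theorem row_cover_nearId (M : Finset ι) (a : ι → Fin 3 → ℝ) {εc ε τc τr η A : ℝ} (Rc : ℝ) (hη : 0 < η) (hεc : 0 ≤ εc)
    (hA : ∀ m ∈ M, ‖posL 1 (a m)‖ ≤ A) (hτ : τc + 3 * η * A ≤ τr) (hεε : εc + 3 * η * (2 + 2 * εc + η) ≤ ε) :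
    (⋃ F ∈ nearIdBox εc, coherentAt (M.image fun m => posL F (a m)) τc Rc)
      ⊆ ⋃ F ∈ ratBox (nearIdBox ε), coherentAt (M.image fun m => posL F (a m)) τr Rc := by
  intro μ hμ
  obtain ⟨F, hF, hcoh⟩ := Set.mem_iUnion₂.mp hμ
  obtain ⟨f, hFf⟩ := exists_rat_near_free F hη
  have hF' : (Matrix.of fun i j => ((f i j : ℚ) : ℝ)) ∈ ratBox (nearIdBox ε) :=
    mem_ratBox f (mem_nearIdBox_of_moved (F' := Matrix.of fun i j => ((f i j : ℚ) : ℝ)) hF hεc (fun i j => hFf i j) hεε)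
  refine Set.mem_iUnion₂.mpr ⟨_, hF', ?_⟩
  have hmove : ∀ m ∈ M, dist (posL F (a m)) (posL (Matrix.of fun i j => ((f i j : ℚ) : ℝ)) (a m)) ≤ τr - τc := by
    intro m hm
    rw [dist_eq_norm]
    refine (norm_posL_sub_posL_le (F' := Matrix.of fun i j => ((f i j : ℚ) : ℝ)) (fun i j => hFf i j) (a m)).trans ?_
    have := mul_le_mul_of_nonneg_left (hA m hm) (by positivity : (0 : ℝ) ≤ 3 * η)
    linarith
  rw [coherentAt_eq_coherentOn] at hcoh ⊢
  have := coherentOn_mono_of_moved M (fun m => posL F (a m)) (fun m => posL (Matrix.of fun i j => ((f i j : ℚ) : ℝ)) (a m))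
    (closedBall (0 : E3) Rc) hmove hcoh
  simpa using this

/-- ★★ **ORIENTATION-FREE GRID TOLERANCE (class H).** [folklore] -/
theorem rowHalo_cover_nearId (M : Finset ι) (a : ι → Fin 3 → ℝ) {εc ε τc τr η A : ℝ} (n : E3) (s Rc : ℝ) (hη : 0 < η) (hεc : 0 ≤ εc)
    (hA : ∀ m ∈ M, ‖posL 1 (a m)‖ ≤ A) (hτ : τc + 3 * η * A ≤ τr) (hεε : εc + 3 * η * (2 + 2 * εc + η) ≤ ε) :
    (⋃ F ∈ nearIdBox εc, coherentOn (M.image fun m => posL F (a m)) τc (haloWindow n s Rc))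
      ⊆ ⋃ F ∈ ratBox (nearIdBox ε), coherentOn (M.image fun m => posL F (a m)) τr (haloWindow n s Rc) := by
  intro μ hμ
  obtain ⟨F, hF, hcoh⟩ := Set.mem_iUnion₂.mp hμ
  obtain ⟨f, hFf⟩ := exists_rat_near_free F hη
  have hF' : (Matrix.of fun i j => ((f i j : ℚ) : ℝ)) ∈ ratBox (nearIdBox ε) :=
    mem_ratBox f (mem_nearIdBox_of_moved (F' := Matrix.of fun i j => ((f i j : ℚ) : ℝ)) hF hεc (fun i j => hFf i j) hεε)
  refine Set.mem_iUnion₂.mpr ⟨_, hF', ?_⟩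
  have hmove : ∀ m ∈ M, dist (posL F (a m)) (posL (Matrix.of fun i j => ((f i j : ℚ) : ℝ)) (a m)) ≤ τr - τc := by
    intro m hm
    rw [dist_eq_norm]
    refine (norm_posL_sub_posL_le (F' := Matrix.of fun i j => ((f i j : ℚ) : ℝ)) (fun i j => hFf i j) (a m)).trans ?_
    have := mul_le_mul_of_nonneg_left (hA m hm) (by positivity : (0 : ℝ) ≤ 3 * η)
    linarith
  have := coherentOn_mono_of_moved M (fun m => posL F (a m)) (fun m => posL (Matrix.of fun i j => ((f i j : ℚ) : ℝ)) (a m))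
    (haloWindow n s Rc) hmove hcoh
  simpa using this

/-- NUMBERS OF RECORD: `ε = 2⁻¹⁰`, `η = 2⁻²⁵`, `ε_cov := 2⁻¹⁰ − 2⁻²² = 4095/4194304` satisfy `ε_cov + 3η(2 + 2ε_cov + η) ≤ ε`
(with (J) `tauCov_le` for the radius). [folklore] -/
theorem epsCov_le : (4095 / 4194304 : ℝ) + 3 * (1 / 33554432) * (2 + 2 * (4095 / 4194304) + 1 / 33554432) ≤ 1 / 1024 := by norm_num

end Summit.AtomisticToContinuum.Crystallization.Theorems.FrustratedLawDichotomyCellGridFree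

end
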